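import Literature.Geometry.Lorentzian.Genericity
import HarnessLib

/-!
# Locality of smooth families of initial data; families constant near the parameter `0`

`InitialDataSet.IsSmoothDataFamily m F` (`Genericity.lean`) asks that the two section maps
`(c, x) ↦ h_c(x)` and `(c, x) ↦ k_c(x)` of a family `F : ℝᵐ → InitialDataSet I X` be `C^∞` on the
product manifold `ℝᵐ × X`. Being a `ContMDiff` condition it is LOCAL on `ℝᵐ × X`: this file
records the pointwise form (`isSmoothDataFamily_iff_contMDiffAt`), the patching principle
(`isSmoothDataFamily_of_locally_eq` — a family that agrees, near every point of `ℝᵐ × X`, with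
some smooth family is smooth) and its working instance for gluing constructions,
`IsSmoothDataFamily.of_eventuallyEq_zero`: a family which is smooth at every parameter `c ≠ 0`
and which, near every point `x`, COINCIDES with `F 0` for all small parameters, is a smooth
family — with no control whatsoever of how fast the region of coincidence exhausts `X`.

This is the parameter-junction step of one-parameter families obtained by gluing a fixed datum
`d = F 0` to `c`-dependent data outside compact sets `K_c` that exhaust `X` as `c → 0` (the data
agree with `d` on `K_c` exactly): smoothness of the family at `c = 0` is automatic, because
Christodoulou's finite-codimension genericity in the typed form `HasCodimAtLeastIn`
(`Genericity.lean`) carries no topology on the space of data and `IsSmoothDataFamily` sees only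
compact parts of `X` at a time. Christodoulou, Class. Quantum Grav. 16 (1999) A23–A35, p. A24
(the notion); the lemmas are folklore differential topology (`ContMDiffAt.congr_of_eventuallyEq`).

## References

* D. Christodoulou, *On the global initial value problem and the issue of singularities*,
  Class. Quantum Grav. **16** (1999) A23–A35, p. A24.
-/

open Bundle Set Filter Function
open scoped Manifold ContDiff Topology

namespace Literature.Geometry.Lorentzian

namespace InitialDataSet

variable {E : Type*} [NormedAddCommGroup E] [NormedSpace ℝ E] {H : Type*} [TopologicalSpace H]
  {I : ModelWithCorners ℝ E H} {X : Type*} [TopologicalSpace X] [ChartedSpace H X]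
  [IsManifold I ∞ X] {m : ℕ}

/-- Pointwise form of `IsSmoothDataFamily`: the two section maps of the family are `C^∞` at every
point of `ℝᵐ × X` (`ContMDiff` is by definition `ContMDiffAt` everywhere). [folklore] -/
theorem isSmoothDataFamily_iff_contMDiffAt (F : EuclideanSpace ℝ (Fin m) → InitialDataSet I X) :
    IsSmoothDataFamily m F ↔ ∀ p : EuclideanSpace ℝ (Fin m) × X,
      ContMDiffAt (𝓘(ℝ, EuclideanSpace ℝ (Fin m)).prod I) (I.prod 𝓘(ℝ, E →L[ℝ] E →L[ℝ] ℝ)) ∞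
          (fun p : EuclideanSpace ℝ (Fin m) × X ↦
            TotalSpace.mk' (F := E →L[ℝ] E →L[ℝ] ℝ)
              (E := fun x : X ↦ TangentSpace I x →L[ℝ] TangentSpace I x →L[ℝ] ℝ) p.2
              ((F p.1).h.inner p.2)) p ∧
        ContMDiffAt (𝓘(ℝ, EuclideanSpace ℝ (Fin m)).prod I) (I.prod 𝓘(ℝ, E →L[ℝ] E →L[ℝ] ℝ)) ∞
          (fun p : EuclideanSpace ℝ (Fin m) × X ↦
            TotalSpace.mk' (F := E →L[ℝ] E →L[ℝ] ℝ)
              (E := fun x : X ↦ TangentSpace I x →L[ℝ] TangentSpace I x →L[ℝ] ℝ) p.2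
              ((F p.1).k p.2)) p :=
  ⟨fun h p ↦ ⟨h.1 p, h.2 p⟩, fun h ↦ ⟨fun p ↦ (h p).1, fun p ↦ (h p).2⟩⟩

/-- **Patching principle.** A family of initial data which, in a neighbourhood of every point of
`ℝᵐ × X`, has the same metric and second-fundamental-form sections as SOME smooth family is a
smooth family (`ContMDiffAt` is invariant under eventual equality). [folklore] -/
theorem isSmoothDataFamily_of_locally_eq {F : EuclideanSpace ℝ (Fin m) → InitialDataSet I X}
    (h : ∀ p : EuclideanSpace ℝ (Fin m) × X, ∃ G : EuclideanSpace ℝ (Fin m) → InitialDataSet I X,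
      IsSmoothDataFamily m G ∧ ∀ᶠ q in 𝓝 p,
        (F q.1).h.inner q.2 = (G q.1).h.inner q.2 ∧ (F q.1).k q.2 = (G q.1).k q.2) :
    IsSmoothDataFamily m F := by
  rw [isSmoothDataFamily_iff_contMDiffAt]
  intro p
  obtain ⟨G, hG, hFG⟩ := h p
  refine ⟨(hG.1 p).congr_of_eventuallyEq ?_, (hG.2 p).congr_of_eventuallyEq ?_⟩
  · filter_upwards [hFG] with q hq
    simp only [hq.1]
  · filter_upwards [hFG] with q hq
    simp only [hq.2]

/-- **Families frozen near the parameter `0` are smooth there.** Let `F : ℝᵐ → InitialDataSet I X`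
be such that (i) at every point `(c, x)` with `c ≠ 0` both section maps `(c, x) ↦ h_c(x)`,
`(c, x) ↦ k_c(x)` are `C^∞`, and (ii) every `x : X` has a neighbourhood on which `F c` and `F 0`
have the same sections for all sufficiently small parameters `c` (jointly: eventually along
`𝓝 (0, x)` in `ℝᵐ × X`). Then `F` is a smooth `m`-parameter family. Near `(0, x)` the family
agrees with the constant family at `F 0` (`isSmoothDataFamily_const`); elsewhere (i) applies.
No rate at which the region of coincidence grows as `c → 0` is needed. [folklore] -/
theorem IsSmoothDataFamily.of_eventuallyEq_zero {F : EuclideanSpace ℝ (Fin m) → InitialDataSet I X}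
    (hF : ∀ p : EuclideanSpace ℝ (Fin m) × X, p.1 ≠ 0 →
      ContMDiffAt (𝓘(ℝ, EuclideanSpace ℝ (Fin m)).prod I) (I.prod 𝓘(ℝ, E →L[ℝ] E →L[ℝ] ℝ)) ∞
          (fun p : EuclideanSpace ℝ (Fin m) × X ↦
            TotalSpace.mk' (F := E →L[ℝ] E →L[ℝ] ℝ)
              (E := fun x : X ↦ TangentSpace I x →L[ℝ] TangentSpace I x →L[ℝ] ℝ) p.2
              ((F p.1).h.inner p.2)) p ∧
        ContMDiffAt (𝓘(ℝ, EuclideanSpace ℝ (Fin m)).prod I) (I.prod 𝓘(ℝ, E →L[ℝ] E →L[ℝ] ℝ)) ∞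
          (fun p : EuclideanSpace ℝ (Fin m) × X ↦
            TotalSpace.mk' (F := E →L[ℝ] E →L[ℝ] ℝ)
              (E := fun x : X ↦ TangentSpace I x →L[ℝ] TangentSpace I x →L[ℝ] ℝ) p.2
              ((F p.1).k p.2)) p)
    (h0 : ∀ x : X, ∀ᶠ q in 𝓝 ((0 : EuclideanSpace ℝ (Fin m)), x),
      (F q.1).h.inner q.2 = (F 0).h.inner q.2 ∧ (F q.1).k q.2 = (F 0).k q.2) :
    IsSmoothDataFamily m F := by
  rw [isSmoothDataFamily_iff_contMDiffAt]
  rintro ⟨c, x⟩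
  by_cases hc : c = 0
  · subst hc
    have hconst := isSmoothDataFamily_const m (F 0)
    refine ⟨(hconst.1 (0, x)).congr_of_eventuallyEq ?_, (hconst.2 (0, x)).congr_of_eventuallyEq ?_⟩
    · filter_upwards [h0 x] with q hq
      simp only [hq.1]
    · filter_upwards [h0 x] with q hq
      simp only [hq.2]
  · exact hF (c, x) hc

/-- The coincidence hypothesis of `IsSmoothDataFamily.of_eventuallyEq_zero` in product form: it
suffices that every `x` have a neighbourhood `U` and the parameter `0` a neighbourhood `V` with
`F c = F 0` on `U` (as sections) for all `c ∈ V`. [folklore] -/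
theorem eventually_nhds_zero_prod_of_forall_nhds {F : EuclideanSpace ℝ (Fin m) → InitialDataSet I X}
    (h : ∀ x : X, ∃ U ∈ 𝓝 x, ∃ V ∈ 𝓝 (0 : EuclideanSpace ℝ (Fin m)), ∀ c ∈ V, ∀ y ∈ U,
      (F c).h.inner y = (F 0).h.inner y ∧ (F c).k y = (F 0).k y) (x : X) :
    ∀ᶠ q in 𝓝 ((0 : EuclideanSpace ℝ (Fin m)), x),
      (F q.1).h.inner q.2 = (F 0).h.inner q.2 ∧ (F q.1).k q.2 = (F 0).k q.2 := by
  obtain ⟨U, hU, V, hV, hUV⟩ := h x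
  rw [nhds_prod_eq]
  exact Filter.mem_of_superset (Filter.prod_mem_prod hV hU) fun q hq ↦ hUV q.1 hq.1 q.2 hq.2

/-- **Gluing form.** A family all of whose members with parameter `c ≠ 0` fit into smooth
families near every point, and which coincides with `F 0` near every point of `X` for all small
parameters (neighbourhood-times-neighbourhood form), is a smooth `m`-parameter family. This is
the junction-at-`c = 0` step for families produced by gluing a fixed datum `F 0` to
`c`-dependent data outside compact sets exhausting `X` as `c → 0`. [folklore] -/
theorem IsSmoothDataFamily.of_forall_nhds_eq_zero {F : EuclideanSpace ℝ (Fin m) → InitialDataSet I X}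
    (hF : ∀ p : EuclideanSpace ℝ (Fin m) × X, p.1 ≠ 0 →
      ∃ G : EuclideanSpace ℝ (Fin m) → InitialDataSet I X, IsSmoothDataFamily m G ∧ ∀ᶠ q in 𝓝 p,
        (F q.1).h.inner q.2 = (G q.1).h.inner q.2 ∧ (F q.1).k q.2 = (G q.1).k q.2)
    (h0 : ∀ x : X, ∃ U ∈ 𝓝 x, ∃ V ∈ 𝓝 (0 : EuclideanSpace ℝ (Fin m)), ∀ c ∈ V, ∀ y ∈ U,
      (F c).h.inner y = (F 0).h.inner y ∧ (F c).k y = (F 0).k y) :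
    IsSmoothDataFamily m F := by
  refine isSmoothDataFamily_of_locally_eq fun p ↦ ?_
  by_cases hc : p.1 = 0
  · refine ⟨fun _ ↦ F 0, isSmoothDataFamily_const m (F 0), ?_⟩
    obtain ⟨c, x⟩ := p
    simp only at hc
    subst hc
    exact eventually_nhds_zero_prod_of_forall_nhds h0 x
  · exact hF p hc

end InitialDataSet

end Literature.Geometry.Lorentzian
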